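import Summits.Ventures.HSemireg.WedgeHankelRecurrenceClasses
import Mathlib.FieldTheory.Separable

/-!
# Venture HSemireg — SYLVESTER'S GAP FOR THE NUMBER OF TERMS (Waring rank vs. middle rank): if a class `q` on `[0, N]` of middle rank `R^N(q) = r` (`2r ≤ N + 1`, minimal recurrence `m`)
# is a sum of `t` geometric sequences with distinct nodes, `q_j = Σ_{i<t} A_i λ_i^j`, then **either `t ≥ N + 2 − r`, or else `t ≥ r`, the class is AFFINE (`deg m = r`) and `m` divides
# `∏_{i<t} (X − λ_i)`** — so `m` is separable and splits among the proposed nodes; consequently **a POLAR class, a class whose minimal recurrence is not separable, or one whose minimal recurrence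
# has no root in `K`, needs at least `N + 2 − r` terms** (conversely N23: if `m = c·∏_{i<r}(X − μ_i)` with distinct `μ_i`, `r` terms suffice)

HONEST FRAMING. Part of the Lean index of the computation cell `pub-hsemireg` (seat p10 gen 29, Sunday typer «UNIFORM-IN-n»).
LINEAR ALGEBRA OF HANKEL (catalecticant) MATRICES and of polynomials over a field ONLY: no variety, no cohomology theory, no sheaf, no Ext group and no semiregularity map is constructed
here; nothing here says that HC / HC_CM / HC_AV holds; no Literature fact is declared or used.  Custodian versions as in `WedgeHankelSiegelIdeal` (1/3); the dictionary («Waring rank of a binary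
form of degree `N` with middle catalecticant rank `r` is `r` if the degree-`r` apolar generator has distinct roots in `K`, and `≥ N + 2 − r` otherwise», Sylvester 1851 / Comas–Seiguer 2011) is
QUOTED, never asserted — the statements below concern sums of geometric sequences `secSeq` agreeing with `q` on `[0, N]`.

WHAT IS IN THE TREE.  N23 (`WedgeHankelRecurrenceSynthesis`, № 176): `secSeq` (via `WedgeHankelSecantRank`), `exists_weights_iff_prod_X_sub_C_mem_recSpace` (`q = secSeq A λ` on `[0, N]` for some weights
`⟺ ∏ (X − λ_i) ∈ Rec_t(q)`), `exists_secSeq_of_prod_X_sub_C_mem_recSpace` (the converse direction used for the affine split case); N19 (№ 174) `prod_X_sub_C_nodes_ne_zero`, `natDegree_prod_X_sub_C_nodes`;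
N18 (№ 173): `recSpace_eq_bot_of_lt`, `dvd_of_mem_recSpace`, `mem_recSpace_iff_exists_mul`, `natDegree_le_of_mem_recSpace`, `mem_degreeLT_succ_iff`; N43 (№ 323): `IsPolarClass`, `IsAffineClass`.
Mathlib: `Polynomial.separable_prod_X_sub_C_iff`, `Polynomial.Separable.of_dvd`, `Polynomial.Separable.squarefree`, `IsCoprime.prod_right`, `Polynomial.dvd_iff_isRoot`, `Irreducible.coprime_iff_not_dvd`,
`IsCoprime.isUnit_of_dvd'`, `Polynomial.natDegree_eq_zero_of_isUnit`.
THIS FILE (namespace `Summit.Ventures.HSemireg.Wedge.HankelOuter` continued; PLAIN on N43 (+ `Mathlib.FieldTheory.Separable`); 0 definitions).  A «`t`-term representation» of `q` is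
`hrep : ∀ j ≤ N, q j = secSeq K A λ j` with `λ : Fin t → K` injective (weights `A` arbitrary, zeros allowed).
* §597 `prod_X_sub_C_mem_recSpace_of_secSeq_agree` (N23 recalled), **`rank_le_of_secSeq_agree`** (`R^N(q) ≤ t` for EVERY representation — no window condition).
* §598 SHORT REPRESENTATIONS (`t + r ≤ N + 1`): **`natDegree_eq_and_dvd_of_secSeq_agree`** (`deg m = r` and `m ∣ ∏ (X − λ_i)`), `isAffineClass_of_secSeq_agree` (no node at `∞`),
  `separable_of_secSeq_agree` (`m` separable, hence squarefree), `exists_isRoot_of_secSeq_agree` (`r ≥ 1 ⇒ m` has a root among the `λ_i`).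
* §599 SYLVESTER'S GAP (`N + 2 ≤ t + r`): **`le_add_of_isPolarClass_of_secSeq_agree`** (polar classes), **`le_add_of_not_separable_of_secSeq_agree`** (non-separable minimal recurrence),
  **`le_add_of_forall_not_isRoot_of_secSeq_agree`** (minimal recurrence without roots in `K`, `r ≥ 1`).
Nothing Ext-side.  New names only.
-/

open Module Polynomial
open scoped Matrix Polynomial

namespace Summit.Ventures.HSemireg.Wedge.HankelOuter

open Summit.Ventures.HSemireg.Wedge Summit.Ventures.HSemireg.Wedge.Hankel Summit.Ventures.HSemireg.Wedge.HankelSecant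

variable (K : Type*) [Field K] {N : ℕ}

/-! ## §597. Every representation is at least as long as the middle rank -/

/-- a `t`-term representation on distinct nodes puts `∏ (X − λ_i)` into `Rec_t(q)` (N23). -/
theorem prod_X_sub_C_mem_recSpace_of_secSeq_agree {t : ℕ} {lam A : Fin t → K} (hlam : Function.Injective lam) {q : ℕ → K} (hrep : ∀ j ≤ N, q j = secSeq K A lam j) :
    (∏ i, (Polynomial.X - Polynomial.C (lam i))) ∈ recSpace K N q t :=
  (exists_weights_iff_prod_X_sub_C_mem_recSpace K hlam q).mp ⟨A, hrep⟩

/-- **`R^N(q) ≤ t` FOR EVERY `t`-TERM REPRESENTATION WITH DISTINCT NODES** (`∏ (X − λ_i) ≠ 0` lies in `Rec_t(q)`, which is `0` below the middle rank). -/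
theorem rank_le_of_secSeq_agree {t : ℕ} {lam A : Fin t → K} (hlam : Function.Injective lam) {q : ℕ → K} (hrep : ∀ j ≤ N, q j = secSeq K A lam j) :
    (hankel1 K N (N / 2) q).rank ≤ t := by
  by_contra hlt
  have hbot := recSpace_eq_bot_of_lt K (rfl : (hankel1 K N (N / 2) q).rank = _) (show t < (hankel1 K N (N / 2) q).rank by omega)
  have hmem := prod_X_sub_C_mem_recSpace_of_secSeq_agree K hlam hrep
  rw [hbot, Submodule.mem_bot] at hmem
  exact prod_X_sub_C_nodes_ne_zero K lam hmem

/-! ## §598. Short representations force an affine class with a split separable minimal recurrence -/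

/-- **A SHORT REPRESENTATION (`t + r ≤ N + 1`) FORCES `deg m = r` AND `m ∣ ∏_{i<t} (X − λ_i)`** for the minimal recurrence `m` (`R^N(q) = r`, `0 ≠ m ∈ Rec_r(q)`): the product is a multiple
`h·m` with `deg h ≤ t − r` inside the window (N18), and degrees compare. -/
theorem natDegree_eq_and_dvd_of_secSeq_agree {r t : ℕ} {q : ℕ → K} {m : K[X]} (hq : (hankel1 K N (N / 2) q).rank = r) (hm : m ∈ recSpace K N q r) (hm0 : m ≠ 0) {lam A : Fin t → K}
    (hlam : Function.Injective lam) (ht : t + r ≤ N + 1) (hrep : ∀ j ≤ N, q j = secSeq K A lam j) :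
    m.natDegree = r ∧ m ∣ ∏ i, (Polynomial.X - Polynomial.C (lam i)) := by
  have hrt : r ≤ t := hq ▸ rank_le_of_secSeq_agree K hlam hrep
  obtain ⟨d, rfl⟩ := Nat.exists_eq_add_of_le hrt
  have hmem := prod_X_sub_C_mem_recSpace_of_secSeq_agree K hlam hrep
  obtain ⟨h, hh, hhm⟩ := (mem_recSpace_iff_exists_mul K hq (by omega) hm hm0).mp hmem
  have hh0 : h ≠ 0 := by rintro rfl; rw [zero_mul] at hhm; exact prod_X_sub_C_nodes_ne_zero K lam hhm.symm
  have hdeg := congrArg Polynomial.natDegree hhm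
  rw [Polynomial.natDegree_mul hh0 hm0, natDegree_prod_X_sub_C_nodes] at hdeg
  have h1 := (mem_degreeLT_succ_iff K).mp hh
  have h2 := natDegree_le_of_mem_recSpace K hm
  exact ⟨by omega, ⟨h, by rw [← hhm, mul_comm]⟩⟩

/-- **… so the class is AFFINE (no node at `∞`).** -/
theorem isAffineClass_of_secSeq_agree {r t : ℕ} {q : ℕ → K} {m : K[X]} (hq : (hankel1 K N (N / 2) q).rank = r) (hm : m ∈ recSpace K N q r) (hm0 : m ≠ 0) {lam A : Fin t → K}
    (hlam : Function.Injective lam) (ht : t + r ≤ N + 1) (hrep : ∀ j ≤ N, q j = secSeq K A lam j) : IsAffineClass K N r q :=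
  ⟨hq, m, hm, hm0, (natDegree_eq_and_dvd_of_secSeq_agree K hq hm hm0 hlam ht hrep).1⟩

/-- **… and the minimal recurrence is SEPARABLE** (it divides the separable `∏ (X − λ_i)`), hence squarefree. -/
theorem separable_of_secSeq_agree {r t : ℕ} {q : ℕ → K} {m : K[X]} (hq : (hankel1 K N (N / 2) q).rank = r) (hm : m ∈ recSpace K N q r) (hm0 : m ≠ 0) {lam A : Fin t → K}
    (hlam : Function.Injective lam) (ht : t + r ≤ N + 1) (hrep : ∀ j ≤ N, q j = secSeq K A lam j) : m.Separable :=
  (Polynomial.separable_prod_X_sub_C_iff.mpr hlam).of_dvd (natDegree_eq_and_dvd_of_secSeq_agree K hq hm hm0 hlam ht hrep).2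

/-- **… and (for `r ≥ 1`) the minimal recurrence has a ROOT among the nodes.** -/
theorem exists_isRoot_of_secSeq_agree {r t : ℕ} {q : ℕ → K} {m : K[X]} (hq : (hankel1 K N (N / 2) q).rank = r) (hr : 1 ≤ r) (hm : m ∈ recSpace K N q r) (hm0 : m ≠ 0) {lam A : Fin t → K}
    (hlam : Function.Injective lam) (ht : t + r ≤ N + 1) (hrep : ∀ j ≤ N, q j = secSeq K A lam j) : ∃ i, m.IsRoot (lam i) := by
  obtain ⟨hdeg, hdvd⟩ := natDegree_eq_and_dvd_of_secSeq_agree K hq hm hm0 hlam ht hrep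
  by_contra hno
  have hcop : IsCoprime m (∏ i, (Polynomial.X - Polynomial.C (lam i))) :=
    IsCoprime.prod_right fun i _ => ((Polynomial.irreducible_X_sub_C (lam i)).coprime_iff_not_dvd.mpr fun h => hno ⟨i, Polynomial.dvd_iff_isRoot.mp h⟩).symm
  have hu : IsUnit m := hcop.isUnit_of_dvd' (dvd_refl m) hdvd
  have := Polynomial.natDegree_eq_zero_of_isUnit hu
  omega

/-! ## §599. Sylvester's gap: otherwise at least `N + 2 − r` terms -/

/-- **A POLAR CLASS NEEDS AT LEAST `N + 2 − r` TERMS: if `q` is polar of rank `r` on `[0, N]`, every representation `q_j = Σ_{i<t} A_i λ_i^j` (`j ≤ N`, distinct `λ_i`) has `t + r ≥ N + 2`.** -/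
theorem le_add_of_isPolarClass_of_secSeq_agree {r t : ℕ} {q : ℕ → K} (hP : IsPolarClass K N r q) (h2 : r + r ≤ N + 1) {lam A : Fin t → K} (hlam : Function.Injective lam)
    (hrep : ∀ j ≤ N, q j = secSeq K A lam j) : N + 2 ≤ t + r := by
  by_contra hlt
  obtain ⟨m, hm0, hspan⟩ := exists_recSpace_self_eq_span K hP.rank_eq h2
  have hm : m ∈ recSpace K N q r := by rw [hspan]; exact Submodule.mem_span_singleton_self m
  exact (isAffineClass_of_secSeq_agree K hP.rank_eq hm hm0 hlam (by omega) hrep).not_isPolarClass hP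

/-- **A CLASS WHOSE MINIMAL RECURRENCE IS NOT SEPARABLE NEEDS AT LEAST `N + 2 − r` TERMS.** -/
theorem le_add_of_not_separable_of_secSeq_agree {r t : ℕ} {q : ℕ → K} {m : K[X]} (hq : (hankel1 K N (N / 2) q).rank = r) (hm : m ∈ recSpace K N q r) (hm0 : m ≠ 0) (hns : ¬ m.Separable)
    {lam A : Fin t → K} (hlam : Function.Injective lam) (hrep : ∀ j ≤ N, q j = secSeq K A lam j) : N + 2 ≤ t + r := by
  by_contra hlt
  exact hns (separable_of_secSeq_agree K hq hm hm0 hlam (by omega) hrep)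

/-- **A CLASS WHOSE MINIMAL RECURRENCE HAS NO ROOT IN `K` NEEDS AT LEAST `N + 2 − r` TERMS** (`r ≥ 1`; e.g. an irreducible `m` of degree `≥ 2`). -/
theorem le_add_of_forall_not_isRoot_of_secSeq_agree {r t : ℕ} {q : ℕ → K} {m : K[X]} (hq : (hankel1 K N (N / 2) q).rank = r) (hr : 1 ≤ r) (hm : m ∈ recSpace K N q r) (hm0 : m ≠ 0)
    (hroot : ∀ x, ¬ m.IsRoot x) {lam A : Fin t → K} (hlam : Function.Injective lam) (hrep : ∀ j ≤ N, q j = secSeq K A lam j) : N + 2 ≤ t + r := by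
  by_contra hlt
  obtain ⟨i, hi⟩ := exists_isRoot_of_secSeq_agree K hq hr hm hm0 hlam (by omega) hrep
  exact hroot _ hi

end Summit.Ventures.HSemireg.Wedge.HankelOuter
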